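import Mathlib
import Summits.HodgeConjecture.FermatCycles.HodgeFermatHypBReductionA
import Summits.HodgeConjecture.FermatCycles.HodgeFermatBadVanishB
import Summits.HodgeConjecture.FermatCycles.HodgeFermatHurwitzZeroB
import Summits.HodgeConjecture.FermatCycles.HodgeFermatHypURange30k
import Summits.HodgeConjecture.FermatCycles.HodgeFermatHypUTailQB

/-!
# THEOREM D6 — unconditional: HYPOTHESIS B reduced to `HypH0` + `HypU`, part 2 (`HodgeFermat/HypBReduction.lean` §§5–7; HF-G23), `HypH0` discharged and B / W / U / D6 from `HypU` (`HurwitzZero.lean` §6; HF-G23), THEOREM D6 in ONE elaboration (`D6OneFile.lean`; HF-G24)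

Tree copy of 3 SMALL MODULES of the sibling cell's standalone package `run/shared/lean/pub/pub-hodgefermat/lean/HodgeFermat/`,
concatenated IN DEPENDENCY ORDER in one tree file (one gate round-trip instead of 3; the hub's import-level build backlog was ≈ 50 min
per level when this file was assembled) — each module's body byte-identical to its source lines, its own `namespace … end` block kept:
  1. `HodgeFermat/HypBReduction.lean` (456 lines, sha256 `6fcdd419c4c074d1…`), part 2 of 2, source lines 255–456 (§§5–7: counting odd characters in `K_p`, the assembly `hypB_of_H0_U`, `thmU_of_H0_U`, `theoremD6_of_H0_U`) — pub-hodgefermat `CERT.md` l.894, GATE HF-G23; cell record `check/HypBReduction_standalone.lean` sha256 `3048bda4e3749181…`;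
  2. `HodgeFermat/HurwitzZero.lean` (528 lines, sha256 `93a0e2eafcc9afc5…`), part 3 of 3 (§6), source lines 500–528 (§6: `hypH0 : HypH0`, `hypB_of_U`, `hypW_of_U`, `thmU_of_U`, `theoremD6_of_U`, `theoremD6_of_range_tail`) — pub-hodgefermat `CERT.md` l.894, GATE HF-G23; cell record `check/HurwitzZero_standalone.lean` sha256 `287d963e8e4eef5a…`; §§1–5 landed 2026-08-25 as `HodgeFermatHurwitzZeroA/B.lean` (prover-1 gen-0);
  3. `HodgeFermat/D6OneFile.lean` (49 lines, sha256 `936cfdd03f0b9531…`), whole module, source lines 25–49 (all: `hypU`, `hypB`, `hypW`, `thmU`, `theoremD6` — THEOREM D6 unconditionally) — pub-hodgefermat `CERT.md` l.903, GATE HF-G24; cell record `check/D6OneFile_standalone.lean` sha256 `a7e9411b43838bb0…`;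
Filed by cell `pub-hfermat`, seat prover-1 gen-3, on the COORDINATOR KEEPER RULING of 2026-08-25 (gem sweep H1: take the
off-gate kernel theorem `thmFstar` through the gate) — here THEOREM F* of `tables/DPRIME-THEOREM.md` §9 IN FULL, i.e.
PROPOSITION D′(3N) and the descent (`HodgeFermat/PropDPrimeNFinal.lean`, GATE HF-G34), the last off-gate form of THEOREM F*
(its first two forms, `DecodingFinal.thmFstar` = F* at the prime levels and `ThmFstarNFinal.thmFstar` = F*(3N), landed on
2026-08-25 as `HodgeFermatThmFstar.lean` / `HodgeFermatThmFstarN.lean`, seats prover-1 gen-0 / gen-2); these modules are links of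
the import closure of `PropDPrimeNFinal.propDprime` (the sibling's KR-free chain: THEOREM L, COROLLARY M, THEOREM D6,
THEOREM U⁺, THEOREM KR6, THEOREM Z3U) on top of those landed chains.  Each source module is the sibling's module of record named in item 1–3 above; declarations are copied VERBATIM.
Deviations from the source modules, exhaustively: the `import` lines (tree modules `Summits.HodgeConjecture.FermatCycles.HodgeFermat*`
instead of `HodgeFermat.*`, hoisted to the top; the source `import` lines between the concatenated modules are dropped); this docstring
(replacing the modules' docstrings, all quoted below); none at file level beyond the concatenation itself; per module: (`import …HodgeFermatHypBReductionA` + `…HodgeFermatBadVanishB` are part 2's imports; `HurwitzZero` §6's `import HodgeFermat.HypBReduction` and `D6OneFile`'s `import HodgeFermat.HurwitzZero` point inside this file)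
  — module 1 (`HypBReduction.lean`): the namespace/`open` preamble (source l.57–59) is repeated at the top because the module is split; DEDUP (pre-empting the gate's `dedup.landed`): four lemmas of the source's §5 are VERBATIM the lemmas that the sibling's later `BadVanish.lean` copied from it and that landed first (`HodgeFermatBadVanishB.lean`, 2026-08-25): `forall_zpowers_iff` (l.261–273, with its `omit … in`), `card_annihilator_mul_orderOf` (l.275–286), `two_mul_card_odd_le` (l.288–332, with its `open Classical in`), `card_K_mul_orderOf` (l.336–343) — DELETED and re-bound by the added line `export HodgeFermat.KRFree.BadVanish (forall_zpowers_iff card_annihilator_mul_orderOf two_mul_card_odd_le card_K_mul_orderOf)` (extra import; same section variables there; `export` rather than `open` so that the qualified names `HypBReduction.card_K_mul_orderOf` … stay available downstream — `TheoremUPlus.lean` l.52–53 uses `card_K_mul_orderOf` / `two_mul_card_odd_le` through `open … HypBReduction`, byte-identically); one-line docstrings added (gate lint) to `badSet_subset`, `two_mul_card_oddK_le`. The module docstring is quoted in full in part 1.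
  — module 2 (`HurwitzZero.lean`): only §6 of the source (l.500–528) is in this file: §§1–5 (l.44–497) are the landed `HodgeFermatHurwitzZeroA.lean`/`HodgeFermatHurwitzZeroB.lean` (2026-08-25, prover-1 gen-0, whose docstring records that §6 was left for the D6 chain); the module docstring is quoted in full in part 1 (`HodgeFermatHurwitzZeroA.lean`).
  — module 3 (`D6OneFile.lean`): none besides these.
Every other line — in particular every declaration's statement and proof — is byte-identical to its source.
HONEST FRAMING: explicit algebraic cycles for specific Hodge classes on Fermat/Delsarte varieties; residual open instances
listed; no claim on general Hodge.  (This file is arithmetic of CM types / finite combinatorics / analytic number theory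
of the sibling's KR-free programme; it claims nothing about cycles.)

(3) The docstring of `HodgeFermat/D6OneFile.lean` (l.8–23), verbatim:

## THEOREM D6 in ONE elaboration (HF-G24)

`theoremD6 : D6` — no two distinct triples of a squarefree level prime to `6` with disjoint entries have
the same CM type — with NO hypotheses, assembled from
* the analytic chain `HurwitzZero.theoremD6_of_U : HypU → D6` (generations 21–23: THEOREM D6 ⇐ L7(c) + U;
  U ⇐ W ⇐ B ⇐ H0 + HypU; `ζ(0, x) = 1/2 - x`),
* `HypUAuto.uRange_2_30001 : URange 2 30001` — HYPOTHESIS U for `N ≤ 3·10⁴` by the certificate-free kernel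
  walk (`HypUAuto.lean`, `HypURange30k.lean`: the certificates are generated AND checked inside the kernel),
* `HypUTailQ.uTail : UTail 30000` — the tail `N > 3·10⁴` (prime-table sharpening of `HypUTail.lean`).

Unlike `D6Final.lean` (generation 23: 37 certificate modules, 16.7 MB, `lake build` only), the transitive
closure of this module over Mathlib is ~430 KB of source and elaborates as ONE hub file
(`check/D6OneFile_standalone.lean`) — THEOREM D6, HYPOTHESIS B, LEMMA W and THEOREM U (squarefree levels
prime to 6) in a single kernel pass, axioms `[propext, Classical.choice, Quot.sound]`.
-/

/-! ## (1/3) `HodgeFermat/HypBReduction.lean` — source lines 255–456 -/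

namespace HodgeFermat.KRFree.HypBReduction

open Finset HodgeFermat.KRFree.LemmaWFourier HurwitzZeta DirichletCharacter

export HodgeFermat.KRFree.BadVanish (forall_zpowers_iff card_annihilator_mul_orderOf two_mul_card_odd_le card_K_mul_orderOf)

/-! ## 5. Counting odd characters in `K_p` (duality) -/

section counting

variable {M : ℕ} [NeZero M]


variable (n p : ℕ) [NeZero n] [Fact p.Prime]


/-- If `-1` is a power of `p` mod `N'`, every character in `K_p` is even. -/
theorem even_of_mem_K (h : ∃ k : ℕ, ((p : ℕ) : ZMod (n / p ^ n.factorization p)) ^ k = -1)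
    {χ : DirichletCharacter ℂ n} (hχ : χ ∈ subgroupOfPrimitiveMapToOne ℂ n p) : χ.Even := by
  haveI : NeZero (n / p ^ n.factorization p) := ⟨(Nat.ordCompl_pos p (NeZero.ne n)).ne'⟩
  obtain ⟨k, hk⟩ := h
  rw [subgroupOfPrimitiveMapToOne, Subgroup.mem_map] at hχ
  obtain ⟨θ, hθ, rfl⟩ := hχ
  rw [DirichletCharacter.mem_annihilator_iff] at hθ
  simp only [Set.mem_singleton_iff, forall_eq, ZMod.coe_unitOfCoprime] at hθ
  have hθeven : θ.Even := by
    show θ (-1) = 1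
    rw [← hk, map_pow, hθ, one_pow]
  show (changeLevel _ θ) (-1) = 1
  have h1 := changeLevel_eq_cast_of_dvd' θ (Nat.ordCompl_dvd n p) (a := -1) (isCoprime_one_left.neg_left)
  push_cast at h1
  rw [h1]
  exact hθeven

end counting

/-! ## 6. Assembly -/

section assembly

open Classical in
/-- The odd characters of `K_p` (empty if `p` is not prime). -/
noncomputable def oddK (N p : ℕ) [NeZero N] : Finset (DirichletCharacter ℂ N) :=
  if hp : p.Prime then
    Finset.univ.filter (fun χ => χ ∈ @subgroupOfPrimitiveMapToOne ℂ _ N _ p (Fact.mk hp) ∧ χ.Odd)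
  else ∅

open Classical in
/-- under `HypH0` the bad characters lie in the union of the `oddK N p` -/
theorem badSet_subset (h0 : HypH0) (N : ℕ) [NeZero N] :
    badSet N ⊆ N.primeFactors.biUnion (fun p => oddK N p) := by
  intro χ hχ
  obtain ⟨p, hp, hmem⟩ := mem_K_of_bad h0 hχ
  have hpp : p.Prime := Nat.prime_of_mem_primeFactors hp
  have hodd : χ.Odd := (Finset.mem_filter.mp hχ).2.1
  rw [Finset.mem_biUnion]
  refine ⟨p, hp, ?_⟩
  rw [oddK, dif_pos hpp]
  exact Finset.mem_filter.mpr ⟨Finset.mem_univ _, hmem hpp, hodd⟩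

open Classical in
/-- `2·#oddK(N, p) ≤ tau N p` at a squarefree level -/
theorem two_mul_card_oddK_le (N p : ℕ) [NeZero N] (hsq : Squarefree N) (hp : p ∈ N.primeFactors) :
    2 * (oddK N p).card ≤ tau N p := by
  have hpp : p.Prime := Nat.prime_of_mem_primeFactors hp
  have hpN : p ∣ N := Nat.dvd_of_mem_primeFactors hp
  haveI := Fact.mk hpp
  have hfac : N.factorization p = 1 := by
    have h1 := (Nat.squarefree_iff_factorization_le_one (NeZero.ne N)).mp hsq p
    have h2 := hpp.factorization_pos_of_dvd (NeZero.ne N) hpN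
    omega
  have hN' : N / p ^ N.factorization p = N / p := by rw [hfac, pow_one]
  have hcop : p.Coprime (N / p) := by
    have := Nat.coprime_ordCompl hpp (NeZero.ne N)
    rwa [hN'] at this
  haveI : NeZero (N / p) := ⟨(Nat.div_pos (Nat.le_of_dvd (NeZero.pos N) hpN) hpp.pos).ne'⟩
  rw [oddK, dif_pos hpp, tau]
  split_ifs with hneg
  · have hneg' : ∃ k : ℕ, ((p : ℕ) : ZMod (N / p ^ N.factorization p)) ^ k = -1 := by
      rw [hN']; exact hneg
    have hempty : Finset.univ.filter
        (fun χ => χ ∈ @subgroupOfPrimitiveMapToOne ℂ _ N _ p (Fact.mk hpp) ∧ χ.Odd) = ∅ := by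
      rw [Finset.filter_eq_empty_iff]
      intro χ _ hχ
      exact DirichletCharacter.not_even_and_odd χ ⟨even_of_mem_K N p hneg' hχ.1, hχ.2⟩
    rw [hempty, Finset.card_empty]
  · have hK := card_K_mul_orderOf N p
    rw [hN'] at hK
    have hle := two_mul_card_odd_le (@subgroupOfPrimitiveMapToOne ℂ _ N _ p (Fact.mk hpp))
    have hpos : 0 < orderOf ((p : ℕ) : ZMod (N / p)) := by
      rw [← ZMod.coe_unitOfCoprime p hcop, orderOf_units]
      exact orderOf_pos _
    calc 2 * (Finset.univ.filter
          (fun χ => χ ∈ @subgroupOfPrimitiveMapToOne ℂ _ N _ p (Fact.mk hpp) ∧ χ.Odd)).card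
        ≤ Nat.card (@subgroupOfPrimitiveMapToOne ℂ _ N _ p (Fact.mk hpp)) := hle
      _ = (N / p).totient / orderOf ((p : ℕ) : ZMod (N / p)) := by
        rw [← hK, Nat.mul_div_cancel _ hpos]

/-- THE REDUCTION: `H0 ∧ U ⟹ B`. -/
theorem hypB_of_H0_U (h0 : HypH0) (hU : HypU) : HypB := by
  intro N h1 hsq h2 h3
  haveI : NeZero N := ⟨by omega⟩
  rw [badCount_eq]
  have hcard : (badSet N).card ≤ ∑ p ∈ N.primeFactors, (oddK N p).card :=
    (Finset.card_le_card (badSet_subset h0 N)).trans Finset.card_biUnion_le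
  have hsum : 2 * ∑ p ∈ N.primeFactors, (oddK N p).card ≤ ∑ p ∈ N.primeFactors, tau N p := by
    rw [Finset.mul_sum]
    exact Finset.sum_le_sum (fun p hp => two_mul_card_oddK_le N p hsq hp)
  have hUN := hU N h1 hsq h2 h3
  omega

end assembly

end HodgeFermat.KRFree.HypBReduction


/-! ## 7. THEOREM U and THEOREM D6 from `HypH0 ∧ HypU` -/

namespace HodgeFermat.KRFree.HypBReduction

open HodgeFermat.KRFree.TheoremD6 HodgeFermat.KRFree.TheoremU HodgeFermat.KRFree.LemmaWFourier

/-- THEOREM U at the squarefree levels prime to 6, from `HypH0` and `HypU`. -/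
theorem thmU_of_H0_U (h0 : HypH0) (hU : HypU) : ThmU := thmU_of_B (hypB_of_H0_U h0 hU)

/-- THEOREM D6 — no disjoint coincidence of CM types at a squarefree level prime to 6 — from the classical value
`ζ(0, x) = 1/2 - x` (`HypH0`) and the group-theoretic count `HypU` alone. -/
theorem theoremD6_of_H0_U (h0 : HypH0) (hU : HypU) : D6 := theoremD6_of_B (hypB_of_H0_U h0 hU)

end HodgeFermat.KRFree.HypBReduction

/-! ## (2/3) `HodgeFermat/HurwitzZero.lean` — source lines 500–528 -/

/-! ## 6. Consequences for the package: `HypH0` holds; HYPOTHESIS B, LEMMA W, THEOREM U, THEOREM D6 from `HypU` alone -/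

namespace HodgeFermat.KRFree.HurwitzZero

open HodgeFermat.KRFree.TheoremD6 HodgeFermat.KRFree.TheoremU HodgeFermat.KRFree.LemmaWFourier
  HodgeFermat.KRFree.HypBReduction

/-- The residual hypothesis `HypH0` of `HypBReduction.lean` (`ζ(0, x) = 1/2 - x` for `0 < x < 1`) is a theorem. -/
theorem hypH0 : HypH0 := fun _ hx0 hx1 => hurwitzZeta_zero hx0 hx1

/-- HYPOTHESIS B of `LemmaWFourier.lean` from the elementary count `HypU` alone. -/
theorem hypB_of_U (hU : HypU) : HypB := hypB_of_H0_U hypH0 hU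

/-- LEMMA W at every squarefree level `N > 1` prime to `6`, from `HypU` alone. -/
theorem hypW_of_U (hU : HypU) : HypW := hypW_of_B (hypB_of_U hU)

/-- THEOREM U (`tables/SEMI-THEOREM.md` §2) at the squarefree levels prime to `6`, from `HypU` alone. -/
theorem thmU_of_U (hU : HypU) : ThmU := thmU_of_H0_U hypH0 hU

/-- THEOREM D6 (`tables/KR-FREE.md`): no two distinct triples of a squarefree level prime to `6` with disjoint entries have
the same CM type — kernel-checked from the single elementary inequality `HypU` (`U(N) < 1/6`, LEMMA S (b)–(c)). -/
theorem theoremD6_of_U (hU : HypU) : D6 := theoremD6_of_H0_U hypH0 hU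

/-- THEOREM D6 from `HypU` on a finite range `2 ≤ N ≤ X` (kernel certificates: `HypUFinite*.lean`, `URange`) and the
tail `N > X` (`UTail`, LEMMA S (b)-style analytic bound) — generation-23 addendum (HF-G23d). -/
theorem theoremD6_of_range_tail (X : ℕ) (hr : URange 2 (X + 1)) (ht : UTail X) : D6 :=
  theoremD6_of_U (hypU_of_range_tail X hr ht)

end HodgeFermat.KRFree.HurwitzZero

/-! ## (3/3) `HodgeFermat/D6OneFile.lean` — source lines 25–49 -/

set_option autoImplicit false

namespace HodgeFermat.KRFree.OneFile

open HodgeFermat.KRFree.HypBReduction HodgeFermat.KRFree.HurwitzZero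
open HodgeFermat.KRFree.TheoremD6 HodgeFermat.KRFree.TheoremU HodgeFermat.KRFree.LemmaWFourier

/-- HYPOTHESIS U (`= LEMMA S`: `U(N) < 1/6` for every squarefree `N > 1` prime to `6`), unconditionally,
from the kernel walk to `3·10⁴` and the tail beyond. -/
theorem hypU : HypU := hypU_of_range_tail 30000 HypUAuto.uRange_2_30001 HypUTailQ.uTail

/-- HYPOTHESIS B of `LemmaWFourier.lean`, unconditionally. -/
theorem hypB : HypB := hypB_of_U hypU

/-- LEMMA W (`HypW`), unconditionally. -/
theorem hypW : HypW := hypW_of_U hypU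

/-- THEOREM U at squarefree levels prime to 6 (`ThmU`), unconditionally. -/
theorem thmU : ThmU := thmU_of_U hypU

/-- **THEOREM D6** (KR-FREE §7): at a squarefree level prime to `6`, two distinct triples with disjoint
entries never have the same CM type — unconditionally, in one elaboration. -/
theorem theoremD6 : D6 := theoremD6_of_U hypU

end HodgeFermat.KRFree.OneFile
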